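import Summits.QuantumFields.BalabanUV.T4Continuum.Support.DirichletBesovTwoLevel
import Summits.QuantumFields.BalabanUV.T4Continuum.Support.DirichletMonotoneCutoffBounds
import Summits.QuantumFields.BalabanUV.Beta.GAN24.DirichletBoxTwoLevel

/-!
# `BalabanUV.T4Continuum.Support.DirichletMonotoneTwoLevel` — NE2 (node U1a) formalisation swarm, SUPPLIER item «Δ1-BESOV» under the
# owner's sub-row `T4-U1a.S-NE2-D1-DIRICHLET°` (wall `hinj`): THE END — THE DIRICHLET TWO-LEVEL INJECTED LAW FOR THE `U = 1` SCALAR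
# MODEL ON EVERY LOCALLY MONOTONE UNION OF UNIT BLOCKS, AT THE GEOMETRIC RATE `√R/√N`, WITH NO DISPLAYED BINDER
# (unit b2b-balaban-t4-ne2-formalise-leaf-08, gen 3, v1)

HONEST FRAMING.  Rung (B)+1 bookkeeping at MODEL level (U = 1 scalar layer `Δ′ = Δ + a′Π′`, King's planting `J₀`), finite torus;
NE2 (U1a) is NOT proved by this file; spine PROVED 0/9 unchanged; NOT infinite volume, NOT the mass gap, NOT Clay.  HONEST DEPENDENCY
(verbatim): «continuum YM on T⁴ ⇐ BetaPertH ∧ nine spine estimates (0/9 proved); BetaPertH ⇐ (D1) ∧ (D4) ∧ CAP+tail; G-an2-4 gates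
asym, D1 and NE2/3/4.»

WHAT THIS FILE PROVES (0 sorry; modules (I)–(III) and the gan24-p2 lineage's `DirichletBox*` BY NAME):
 * §1 **`locallyMonotone_of_isCoordBox`**: every coordinate box of unit blocks (`DirichletBoxTwoLevel.IsCoordBox` — boxes, slabs,
   wrapping or not) is LOCALLY MONOTONE; so the class of module (II) CONTAINS gan24-p2's class, and it also contains L-shapes,
   complements of boxes, Fichera corners … (regions with re-entrant edges, where the discrete `H²` identity fails);
 * §2 **THE END `injected_le_of_locallyMonotone`**:
   `LocallyMonotone M S → 1 ≤ N → 2 ≤ R·N → 0 < a′ →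
    ‖(D′^{Ω′})⁻¹·J^Ω − J^Ω·(D^Ω)⁻¹‖ ≤ besovConst d a′ 6 48 · √R / √N`
   for `Ω = blockReg N M S`, `Ω′ = refineR N R M Ω` — LITERALLY the shape of gan24-p2's `DirichletBoxTwoLevel.injected_le_box`
   (there: `IsCoordBox`, rate `Cbox/N`) and of the owner's displayed wall `hinj`∕`hinjS` for the scalar carriers, now on the larger
   class at the weaker GEOMETRIC rate: along the tower `N = L^k`, `R = L`, `e₁ k = besovConst·√L·(L^{−1/2})^k`, `θ = L^{−1/2} ∈ [L⁻¹,1)`,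
   consumable by `DirichletFreeTower.towerLimitRate_dirichlet_of_injected` ∕ the owner's O12-b `towerLimitRate_dirichletScalar_of_injected`
   at that rate.  Assembly: (II) `exists_admissibleCutoff` (cutoffs `ψ_μ`, `ℓ₁ = 6/(RN)`, `ℓ₂ = 48/(RN)²`) transported along
   `DirichletBoxTwoLevelCore.refineR_blockReg_iff` (`Ω′ = blockReg (RN) S` pointwise) into (III) `opNorm_defect_le_of_admissibleCutoffs`.

ABSOLUTE RULE (cell, verbatim): «No internally-minted statement may enter as a cited fact. Every hypothesis is either kernel-proved in
this package or a verbatim quotation of a PUBLISHED theorem with page reference. The manuscript(s) under audit are NOT citable for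
their own disputed steps — they are the thing under adjudication; programme-internal (2001/route/tribunal) claims are never citable.»
[folklore]; no `def … : Prop` fact; the only hypotheses of the END are `LocallyMonotone S`, `1 ≤ N`, `2 ≤ R·N`, `0 < a′`.
NOT CLAIMED: rate `N^{−1}` on non-convex regions (leaf-07-g4's numerics measure exponent 1; this method gives 1/2); non-monotone regions
(the checkerboard pair, the 4-chain around a vertex); the VECTOR operator `calDalev` ∕ the printed gauge term (owner's G-ne2p1-g12-1);
NE2; NE3; «not in print; our proof».
-/

noncomputable section

open scoped BigOperators ComplexConjugate Matrix Matrix.Norms.L2Operator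
open Finset

namespace Summit.QuantumFields.BalabanUV.T4Continuum.DirichletMonotoneTwoLevel

open Literature.MathematicalPhysics.QuantumFieldTheory.Balaban1983to89.B5Prop11Plancherel (Tor fine unitVec)
open Summit.QuantumFields.BalabanUV.T4Continuum.DirichletDirectionalBesovCutoff (AdmissibleCutoff)
open Summit.QuantumFields.BalabanUV.T4Continuum.DirichletBesovTwoLevel (besovConst opNorm_defect_le_of_admissibleCutoffs)
open Summit.QuantumFields.BalabanUV.T4Continuum.DirichletMonotoneCutoff (InPatch DownClosed UpClosed LocallyMonotone
  exists_admissibleCutoff)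
open Summit.QuantumFields.BalabanUV.Beta.GAN24.DirichletBoxTrace (blockReg)
open Summit.QuantumFields.BalabanUV.Beta.GAN24.DirichletBoxCompression (DOm JOm refineR)
open Summit.QuantumFields.BalabanUV.Beta.GAN24.DirichletBoxTwoLevelCore (refineR_blockReg_iff)
open Summit.QuantumFields.BalabanUV.Beta.GAN24.DirichletBoxTwoLevel (IsCoordBox)

variable {d : ℕ}

/-! ## §1 Coordinate boxes are locally monotone -/

/-- **every coordinate box of unit blocks is locally monotone**: at a vertex `v` and axis `μ`, if the upper coordinate `v μ` is admissible
the patch is upward-closed, otherwise it is (vacuously) downward-closed. [folklore] -/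
theorem locallyMonotone_of_isCoordBox (M : Fin d → ℕ) [∀ μ, NeZero (M μ)] {S : Tor M → Prop} (hS : IsCoordBox M S) :
    LocallyMonotone M S := by
  obtain ⟨S₀, hS₀⟩ := hS
  intro v μ
  by_cases hv : v μ ∈ S₀ μ
  · refine Or.inr fun b _ hbμ hb => ?_
    rw [hS₀] at hb ⊢
    intro ν
    by_cases hν : ν = μ
    · subst hν; simpa [unitVec, ← hbμ] using hv
    · simpa [unitVec, hν] using hb ν
  · refine Or.inl fun b _ hbμ hb => ?_
    rw [hS₀] at hb
    exact absurd (hbμ ▸ hb μ) hv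

/-! ## §2 THE END: the two-level injected law on locally monotone unions of unit blocks -/

section TwoLevel

variable (N R : ℕ) [NeZero N] [NeZero R] (M : Fin d → ℕ) [hM : ∀ μ, NeZero (M μ)] (S : Tor M → Prop) [DecidablePred S]

/-- **THE DIRICHLET TWO-LEVEL INJECTED LAW ON A LOCALLY MONOTONE UNION OF UNIT BLOCKS** (U = 1 scalar model, no displayed binder):
`‖(D′^{Ω′})⁻¹·J^Ω − J^Ω·(D^Ω)⁻¹‖ ≤ besovConst(d, a′, 6, 48)·√R/√N` for `Ω = blockReg N M S`, `Ω′ = refineR N R M Ω` — the owner's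
wall `hinj` ∕ gan24-p2's M-E shape, on every locally monotone `S` (boxes AND re-entrant configurations), at the geometric rate
`θ = L^{−1/2}` along `N = L^k`, `R = L`. [folklore] -/
theorem injected_le_of_locallyMonotone (hS : LocallyMonotone M S) (hN : 1 ≤ N) (hRN : 2 ≤ R * N) {a' : ℝ} (ha' : 0 < a') :
    ‖(DOm (R * N) M a' (refineR N R M (blockReg N M S)))⁻¹ * JOm N R M (blockReg N M S)
        - JOm N R M (blockReg N M S) * (DOm N M a' (blockReg N M S))⁻¹‖
      ≤ besovConst d a' 6 48 * Real.sqrt R / Real.sqrt N := by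
  refine opNorm_defect_le_of_admissibleCutoffs N R M a' (blockReg N M S) ha' hN (by norm_num) (by norm_num) fun μ => ?_
  obtain ⟨ψ, hψ⟩ := exists_admissibleCutoff (R * N) M S hRN hS μ
  exact ⟨ψ, hψ.of_iff (refineR_blockReg_iff N R M S)⟩

/-- in particular on every COORDINATE BOX (gan24-p2's class; their `injected_le_box` gives the better rate `Cbox/N` there — this is the
consistency face of the Besov route). [folklore] -/
theorem injected_le_of_isCoordBox (hS : IsCoordBox M S) (hN : 1 ≤ N) (hRN : 2 ≤ R * N) {a' : ℝ} (ha' : 0 < a') :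
    ‖(DOm (R * N) M a' (refineR N R M (blockReg N M S)))⁻¹ * JOm N R M (blockReg N M S)
        - JOm N R M (blockReg N M S) * (DOm N M a' (blockReg N M S))⁻¹‖
      ≤ besovConst d a' 6 48 * Real.sqrt R / Real.sqrt N :=
  injected_le_of_locallyMonotone N R M S (locallyMonotone_of_isCoordBox M hS) hN hRN ha'

end TwoLevel

end Summit.QuantumFields.BalabanUV.T4Continuum.DirichletMonotoneTwoLevel

end
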